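import Mathlib
import Summits.KontsevichZagierPeriods.KontsevichZagierPeriods.Theorems.SoloInformedSecondKindInversion
import HarnessLib
import HarnessLib.Audit

/-!
# The second-kind cycle relations W45 and W25 at level 6 (solo-informed, s23) — THEOREM XIII′/XIII″

Instances of the second-kind inversion chain (THEOREM XIII, `SoloInformedSecondKindInversion`:
`⟦[pt,4^q]⟧ · ⟦[pt,p−½]⟧ · ⟦β(q,2p−1)⟧ = ⟦β(p,q)⟧` for `q = 3/2 − p`) on the curve `y² = x³ + 1`
(level 6), where `β(⅚,⅔)`, `β(⅔,⅚)`, `β(⅚,⅓)`, `β(⅓,⅚)` are the Beta periods of the SECOND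
kind (value `Γ(⅔)Γ(⅚)/√π ∈ ℚ̄^× · 2√3π / B(⅙,½)`):
* value form of Theorem XIII: `4^q (p − ½) B(q, 2p−1) = B(p, q)`;
* `p = ⅚`: `⟦[pt,4^{2/3}]⟧·⟦[pt,⅓]⟧·⟦β(⅔,⅔)⟧ = ⟦β(⅚,⅔)⟧`; with the duplication move at `a = ⅔`
  (`⟦[pt,4^{2/3}]⟧·⟦β(⅔,⅔)⟧ = 2⟦β(⅔,½)⟧`, `SoloInformedDuplicationChain`) this is **W45**:
  `3 · ⟦β(⅚,⅔)⟧ = 2 · ⟦β(⅔,½)⟧` (`soloInformed_secondKind_W45`), value `3 B(⅚,⅔) = 2 B(⅔,½)`;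
* `p = ⅔`: `⟦[pt,4^{5/6}]⟧·⟦[pt,⅙]⟧·⟦β(⅚,⅓)⟧ = ⟦β(⅔,⅚)⟧`; with the reflection `t ↦ 1 − t` and
  W45 this is **W25**: `⟦[pt,4^{5/6}]⟧ · ⟦β(⅚,⅓)⟧ = 4 · ⟦β(⅔,½)⟧` (`soloInformed_secondKind_W25`),
  value `4^{5/6} B(⅚,⅓) = 4 B(⅔,½)`.
Consequently `⟦β(⅚,⅔)⟧` and `⟦β(⅚,⅓)⟧` (and, by the reflection chains, their swaps) lie in every
`K`-hull containing `⟦β(⅔,½)⟧` (`soloInformed_betaFiveSixths*_mem_algHull`): the second-kind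
classes of level 6 are decided BY THE MOVES relative to `⟦β(⅔,½)⟧`, with no cancellation and no
`π`.  (For PAIRS of pinned Beta representations the level-6 rung is closed in the tree by route
FermatIsogeny, `BetaLinearSector.SixthsMax`, via second-kind transport along the real 3-isogeny;
the present files give the quadratic one-variable mechanism and the general family.)

References: M. Kontsevich, D. Zagier, *Periods* (2001), §1.2; G. Andrews, R. Askey, R. Roy,
*Special Functions* (1999), §1.1, Thm. 1.5.1; this work (solo-informed s23).
-/

noncomputable section

open MeasureTheory Set Filter
open scoped Classical

open Literature.NumberTheory.Transcendental Literature.NumberTheory.Transcendental.KZ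
open Literature.ModelTheory.ExponentialFields

namespace Summit.KontsevichZagierPeriods.KontsevichZagierPeriods.Theorems

/-! ### Point classes of naturals -/

/-- `⟦[pt, n]⟧ = n` in `P` for a natural number `n`. [Kontsevich–Zagier 2001, §1.2] -/
theorem soloInformed_pointRep_natCast (n : ℕ) (h : IsAlgebraic ℚ ((n : ℝ))) :
    toFormalPeriod (of (IntegralRep.unit.constMul (n : ℝ) h)) = n := by
  rw [← soloInformed_pointHom_apply (n : ℝ) (soloInformed_mem_integralClosure_of_isAlgebraic h) h]
  have : (⟨(n : ℝ), soloInformed_mem_integralClosure_of_isAlgebraic h⟩ : integralClosure ℚ ℝ) =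
      (n : integralClosure ℚ ℝ) := Subtype.ext (by simp)
  rw [this, map_natCast]

/-! ### Value form of Theorem XIII -/

/-- **Value form of Theorem XIII**: `4^q · (c · B(q, b)) = B(p, q)` (`q = 3/2 − p`, `b = 2p − 1`,
`c = p − ½`), i.e. `B(p, 3/2 − p) = 4^{3/2 − p} (p − ½) B(3/2 − p, 2p − 1)` — here a COROLLARY of
three moves of the calculus. [Andrews–Askey–Roy 1999, §1.1; this work] -/
theorem soloInformed_secondKind_inversion_value (p q b c : ℚ) (hq : q = 3 / 2 - p)
    (hb : b = 2 * p - 1) (hc : c = p - 1 / 2) (hp : 1 / 2 < p) (hp' : p < 3 / 2)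
    (A B : IntegralRep 1)
    (hAd : A.domain = {t | t 0 ∈ Ioo (0:ℝ) 1})
    (hAi : EqOn A.integrand
      (fun t => (t 0) ^ ((q : ℝ) - 1) * (1 - t 0) ^ ((b : ℝ) - 1)) A.domain)
    (hBd : B.domain = {t | t 0 ∈ Ioo (0:ℝ) 1})
    (hBi : EqOn B.integrand
      (fun t => (t 0) ^ ((p : ℝ) - 1) * (1 - t 0) ^ ((q : ℝ) - 1)) B.domain) :
    (4:ℝ) ^ (q : ℝ) * ((c : ℝ) * A.value) = B.value := by
  have h4 : IsAlgebraic ℚ ((4:ℝ) ^ (q : ℝ)) := by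
    simpa using soloInformed_isAlgebraic_natCast_rpow_ratCast 4 (by norm_num) q
  have hca : IsAlgebraic ℚ ((c : ℝ)) := isAlgebraic_algebraMap (c : ℚ)
  have h := congr_arg evalP
    (soloInformed_secondKind_inversion_chain p q b c hq hb hc hp hp' h4 hca A B hAd hAi hBd hBi)
  simpa only [map_mul, evalP_toFormalPeriod_of, IntegralRep.value_constMul, IntegralRep.value_unit,
    mul_one] using h

/-! ### W45: `3 · ⟦β(⅚,⅔)⟧ = 2 · ⟦β(⅔,½)⟧` -/

/-- **THEOREM XIII′ (W45).** For pinned `B₅₄ = β(⅚,⅔)` and `B₄₃ = β(⅔,½)`: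
`3 · ⟦B₅₄⟧ = 2 · ⟦B₄₃⟧` in the formal period ring — Theorem XIII at `p = ⅚`
(`⟦[pt,4^{2/3}]⟧·⟦[pt,⅓]⟧·⟦β(⅔,⅔)⟧ = ⟦β(⅚,⅔)⟧`) and the duplication move at `a = ⅔`
(`⟦[pt,4^{2/3}]⟧·⟦β(⅔,⅔)⟧ = 2⟦β(⅔,½)⟧`). The period `B(⅚,⅔) = 3∫₀^∞ x dx/y³` of the second kind on
`y² = x³ + 1` is thereby tied to `B(⅔,½)` BY THE MOVES, with no cancellation. [this work] -/
theorem soloInformed_secondKind_W45 (B₅₄ B₄₃ : IntegralRep 1)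
    (h54d : B₅₄.domain = {t | t 0 ∈ Ioo (0:ℝ) 1})
    (h54i : EqOn B₅₄.integrand
      (fun t => (t 0) ^ (((5 / 6 : ℚ) : ℝ) - 1) * (1 - t 0) ^ (((2 / 3 : ℚ) : ℝ) - 1)) B₅₄.domain)
    (h43d : B₄₃.domain = {t | t 0 ∈ Ioo (0:ℝ) 1})
    (h43i : EqOn B₄₃.integrand
      (fun t => (t 0) ^ (((2 / 3 : ℚ) : ℝ) - 1) * (1 - t 0) ^ (((1 / 2 : ℚ) : ℝ) - 1)) B₄₃.domain) :
    3 * toFormalPeriod (of B₅₄) = 2 * toFormalPeriod (of B₄₃) := by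
  have h4 : IsAlgebraic ℚ ((4:ℝ) ^ (((2 / 3 : ℚ)) : ℝ)) := by
    simpa using soloInformed_isAlgebraic_natCast_rpow_ratCast 4 (by norm_num) (2 / 3)
  have h3i : IsAlgebraic ℚ ((((1 / 3 : ℚ)) : ℝ)) := isAlgebraic_algebraMap (1 / 3 : ℚ)
  have h3 : IsAlgebraic ℚ (((3 : ℕ) : ℝ)) := isAlgebraic_nat 3
  obtain ⟨B₄₄, h44d, h44i⟩ := exists_betaRep' (2 / 3) (2 / 3) (by norm_num) (by norm_num)
  -- Theorem XIII at p = 5/6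
  have hmove := soloInformed_secondKind_inversion_chain (5 / 6) (2 / 3) (2 / 3) (1 / 3)
    (by norm_num) (by norm_num) (by norm_num) (by norm_num) (by norm_num) h4 h3i B₄₄ B₅₄ h44d
    (fun x _ => by rw [h44i]) h54d h54i
  -- the duplication move at a = 2/3
  have hdup := soloInformed_duplication_chain (2 / 3) h4 B₄₄ B₄₃ h44d (fun x _ => by rw [h44i])
    h43d h43i
  -- `⟦pt,⅓⟧ · 3 = 1`
  have h3inv : IsAlgebraic ℚ (((3 : ℕ) : ℝ))⁻¹ := by
    rw [show (((3 : ℕ) : ℝ))⁻¹ = (((1 / 3 : ℚ)) : ℝ) by push_cast; norm_num]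
    exact h3i
  have hunit : toFormalPeriod (of (IntegralRep.unit.constMul (((3 : ℕ) : ℝ))⁻¹ h3inv)) *
      toFormalPeriod (of (IntegralRep.unit.constMul (((3 : ℕ) : ℝ)) h3)) = 1 :=
    soloInformed_pointRep_inv_mul _ h3 (by norm_num) h3inv
  have hcongr : toFormalPeriod (of (IntegralRep.unit.constMul ((((1 / 3 : ℚ)) : ℝ)) h3i)) =
      toFormalPeriod (of (IntegralRep.unit.constMul (((3 : ℕ) : ℝ))⁻¹ h3inv)) :=
    soloInformed_pointRep_congr h3i h3inv (by push_cast; norm_num)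
  have hnat : toFormalPeriod (of (IntegralRep.unit.constMul (((3 : ℕ) : ℝ)) h3)) = 3 := by
    rw [soloInformed_pointRep_natCast]; norm_num
  have hthird :
      toFormalPeriod (of (IntegralRep.unit.constMul ((((1 / 3 : ℚ)) : ℝ)) h3i)) * 3 = 1 := by
    rw [hcongr, ← hnat, hunit]
  linear_combination (-3 : FormalPeriodRing) * hmove +
    (toFormalPeriod (of (IntegralRep.unit.constMul ((4:ℝ) ^ (((2 / 3 : ℚ)) : ℝ)) h4)) *
      toFormalPeriod (of B₄₄)) * hthird + hdup

/-- **Value form of W45**: `3 · B(⅚,⅔) = 2 · B(⅔,½)`. [this work] -/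
theorem soloInformed_secondKind_W45_value (B₅₄ B₄₃ : IntegralRep 1)
    (h54d : B₅₄.domain = {t | t 0 ∈ Ioo (0:ℝ) 1})
    (h54i : EqOn B₅₄.integrand
      (fun t => (t 0) ^ (((5 / 6 : ℚ) : ℝ) - 1) * (1 - t 0) ^ (((2 / 3 : ℚ) : ℝ) - 1)) B₅₄.domain)
    (h43d : B₄₃.domain = {t | t 0 ∈ Ioo (0:ℝ) 1})
    (h43i : EqOn B₄₃.integrand
      (fun t => (t 0) ^ (((2 / 3 : ℚ) : ℝ) - 1) * (1 - t 0) ^ (((1 / 2 : ℚ) : ℝ) - 1)) B₄₃.domain) :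
    3 * B₅₄.value = 2 * B₄₃.value := by
  have h := congr_arg evalP (soloInformed_secondKind_W45 B₅₄ B₄₃ h54d h54i h43d h43i)
  simpa only [map_mul, map_ofNat, evalP_toFormalPeriod_of] using h

/-- **`⟦β(⅚,⅔)⟧` lies in the `K`-hull of any family whose hull contains `⟦β(⅔,½)⟧`**
(`⟦β(⅚,⅔)⟧ = ⟦[pt,⅓]⟧ · (⟦β(⅔,½)⟧ + ⟦β(⅔,½)⟧)`). [this work] -/
theorem soloInformed_betaFiveSixthsTwoThirds_mem_algHull (B₅₄ B₄₃ : IntegralRep 1)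
    (h54d : B₅₄.domain = {t | t 0 ∈ Ioo (0:ℝ) 1})
    (h54i : EqOn B₅₄.integrand
      (fun t => (t 0) ^ (((5 / 6 : ℚ) : ℝ) - 1) * (1 - t 0) ^ (((2 / 3 : ℚ) : ℝ) - 1)) B₅₄.domain)
    (h43d : B₄₃.domain = {t | t 0 ∈ Ioo (0:ℝ) 1})
    (h43i : EqOn B₄₃.integrand
      (fun t => (t 0) ^ (((2 / 3 : ℚ) : ℝ) - 1) * (1 - t 0) ^ (((1 / 2 : ℚ) : ℝ) - 1)) B₄₃.domain)
    {k : ℕ} (cs : Fin k → FormalPeriodRing)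
    (hB : toFormalPeriod (of B₄₃) ∈ soloInformedAlgHull cs) :
    toFormalPeriod (of B₅₄) ∈ soloInformedAlgHull cs := by
  have h3 : IsAlgebraic ℚ (((3 : ℕ) : ℝ)) := isAlgebraic_nat 3
  have h3inv : IsAlgebraic ℚ (((3 : ℕ) : ℝ))⁻¹ := by
    rw [show (((3 : ℕ) : ℝ))⁻¹ = (((1 / 3 : ℚ)) : ℝ) by push_cast; norm_num]
    exact isAlgebraic_algebraMap (1 / 3 : ℚ)
  have hW := soloInformed_secondKind_W45 B₅₄ B₄₃ h54d h54i h43d h43i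
  have hunit : toFormalPeriod (of (IntegralRep.unit.constMul (((3 : ℕ) : ℝ))⁻¹ h3inv)) *
      toFormalPeriod (of (IntegralRep.unit.constMul (((3 : ℕ) : ℝ)) h3)) = 1 :=
    soloInformed_pointRep_inv_mul _ h3 (by norm_num) h3inv
  have hnat : toFormalPeriod (of (IntegralRep.unit.constMul (((3 : ℕ) : ℝ)) h3)) = 3 := by
    rw [soloInformed_pointRep_natCast]; norm_num
  have hB₅₄ : toFormalPeriod (of B₅₄) =
      toFormalPeriod (of (IntegralRep.unit.constMul (((3 : ℕ) : ℝ))⁻¹ h3inv)) *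
        (toFormalPeriod (of B₄₃) + toFormalPeriod (of B₄₃)) := by
    calc toFormalPeriod (of B₅₄)
        = toFormalPeriod (of (IntegralRep.unit.constMul (((3 : ℕ) : ℝ))⁻¹ h3inv)) *
            toFormalPeriod (of (IntegralRep.unit.constMul (((3 : ℕ) : ℝ)) h3)) *
            toFormalPeriod (of B₅₄) := by rw [hunit, one_mul]
      _ = toFormalPeriod (of (IntegralRep.unit.constMul (((3 : ℕ) : ℝ))⁻¹ h3inv)) *
            (3 * toFormalPeriod (of B₅₄)) := by rw [hnat, mul_assoc]
      _ = _ := by rw [hW, two_mul]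
  rw [hB₅₄]
  exact mul_mem (soloInformed_pointRep_mem_algHull cs _ h3inv) (add_mem hB hB)

/-! ### W25: `⟦[pt,4^{5/6}]⟧ · ⟦β(⅚,⅓)⟧ = 4 · ⟦β(⅔,½)⟧` -/

/-- **THEOREM XIII″ (W25).** For pinned `B₅₂ = β(⅚,⅓)` and `B₄₃ = β(⅔,½)`:
`⟦[pt,4^{5/6}]⟧ · ⟦B₅₂⟧ = 4 · ⟦B₄₃⟧` — Theorem XIII at `p = ⅔`
(`⟦[pt,4^{5/6}]⟧·⟦[pt,⅙]⟧·⟦β(⅚,⅓)⟧ = ⟦β(⅔,⅚)⟧`), the reflection `t ↦ 1 − t`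
(`⟦β(⅔,⅚)⟧ = ⟦β(⅚,⅔)⟧`) and W45. Value: `4^{5/6} B(⅚,⅓) = 4 B(⅔,½)`. [this work] -/
theorem soloInformed_secondKind_W25 (h4 : IsAlgebraic ℚ ((4:ℝ) ^ (((5 / 6 : ℚ)) : ℝ)))
    (B₅₂ B₄₃ : IntegralRep 1)
    (h52d : B₅₂.domain = {t | t 0 ∈ Ioo (0:ℝ) 1})
    (h52i : EqOn B₅₂.integrand
      (fun t => (t 0) ^ (((5 / 6 : ℚ) : ℝ) - 1) * (1 - t 0) ^ (((1 / 3 : ℚ) : ℝ) - 1)) B₅₂.domain)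
    (h43d : B₄₃.domain = {t | t 0 ∈ Ioo (0:ℝ) 1})
    (h43i : EqOn B₄₃.integrand
      (fun t => (t 0) ^ (((2 / 3 : ℚ) : ℝ) - 1) * (1 - t 0) ^ (((1 / 2 : ℚ) : ℝ) - 1)) B₄₃.domain) :
    toFormalPeriod (of (IntegralRep.unit.constMul ((4:ℝ) ^ (((5 / 6 : ℚ)) : ℝ)) h4)) *
      toFormalPeriod (of B₅₂) = 4 * toFormalPeriod (of B₄₃) := by
  have h6i : IsAlgebraic ℚ ((((1 / 6 : ℚ)) : ℝ)) := isAlgebraic_algebraMap (1 / 6 : ℚ)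
  have h6 : IsAlgebraic ℚ (((6 : ℕ) : ℝ)) := isAlgebraic_nat 6
  obtain ⟨B₄₅, h45d, h45i⟩ := exists_betaRep' (2 / 3) (5 / 6) (by norm_num) (by norm_num)
  obtain ⟨B₅₄, h54d, h54i⟩ := exists_betaRep' (5 / 6) (2 / 3) (by norm_num) (by norm_num)
  -- Theorem XIII at p = 2/3
  have hmove := soloInformed_secondKind_inversion_chain (2 / 3) (5 / 6) (1 / 3) (1 / 6)
    (by norm_num) (by norm_num) (by norm_num) (by norm_num) (by norm_num) h4 h6i B₅₂ B₄₅ h52d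
    h52i h45d (fun x _ => by rw [h45i])
  -- reflection and W45
  have hswap := soloInformed_beta_swap (2 / 3) (5 / 6) B₄₅ B₅₄ h45d (fun x _ => by rw [h45i]) h54d
    (fun x _ => by rw [h54i])
  have hW45 := soloInformed_secondKind_W45 B₅₄ B₄₃ h54d (fun x _ => by rw [h54i]) h43d h43i
  -- `⟦pt,⅙⟧ · 6 = 1`
  have h6inv : IsAlgebraic ℚ (((6 : ℕ) : ℝ))⁻¹ := by
    rw [show (((6 : ℕ) : ℝ))⁻¹ = (((1 / 6 : ℚ)) : ℝ) by push_cast; norm_num]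
    exact h6i
  have hunit : toFormalPeriod (of (IntegralRep.unit.constMul (((6 : ℕ) : ℝ))⁻¹ h6inv)) *
      toFormalPeriod (of (IntegralRep.unit.constMul (((6 : ℕ) : ℝ)) h6)) = 1 :=
    soloInformed_pointRep_inv_mul _ h6 (by norm_num) h6inv
  have hcongr : toFormalPeriod (of (IntegralRep.unit.constMul ((((1 / 6 : ℚ)) : ℝ)) h6i)) =
      toFormalPeriod (of (IntegralRep.unit.constMul (((6 : ℕ) : ℝ))⁻¹ h6inv)) :=
    soloInformed_pointRep_congr h6i h6inv (by push_cast; norm_num)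
  have hnat : toFormalPeriod (of (IntegralRep.unit.constMul (((6 : ℕ) : ℝ)) h6)) = 6 := by
    rw [soloInformed_pointRep_natCast]; norm_num
  have hsixth :
      toFormalPeriod (of (IntegralRep.unit.constMul ((((1 / 6 : ℚ)) : ℝ)) h6i)) * 6 = 1 := by
    rw [hcongr, ← hnat, hunit]
  linear_combination (6 : FormalPeriodRing) * hmove + 6 * hswap + 2 * hW45 -
    (toFormalPeriod (of (IntegralRep.unit.constMul ((4:ℝ) ^ (((5 / 6 : ℚ)) : ℝ)) h4)) *
      toFormalPeriod (of B₅₂)) * hsixth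

/-- **Value form of W25**: `4^{5/6} · B(⅚,⅓) = 4 · B(⅔,½)`. [this work] -/
theorem soloInformed_secondKind_W25_value (B₅₂ B₄₃ : IntegralRep 1)
    (h52d : B₅₂.domain = {t | t 0 ∈ Ioo (0:ℝ) 1})
    (h52i : EqOn B₅₂.integrand
      (fun t => (t 0) ^ (((5 / 6 : ℚ) : ℝ) - 1) * (1 - t 0) ^ (((1 / 3 : ℚ) : ℝ) - 1)) B₅₂.domain)
    (h43d : B₄₃.domain = {t | t 0 ∈ Ioo (0:ℝ) 1})
    (h43i : EqOn B₄₃.integrand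
      (fun t => (t 0) ^ (((2 / 3 : ℚ) : ℝ) - 1) * (1 - t 0) ^ (((1 / 2 : ℚ) : ℝ) - 1)) B₄₃.domain) :
    (4:ℝ) ^ (((5 / 6 : ℚ)) : ℝ) * B₅₂.value = 4 * B₄₃.value := by
  have h4 : IsAlgebraic ℚ ((4:ℝ) ^ (((5 / 6 : ℚ)) : ℝ)) := by
    simpa using soloInformed_isAlgebraic_natCast_rpow_ratCast 4 (by norm_num) (5 / 6)
  have h := congr_arg evalP (soloInformed_secondKind_W25 h4 B₅₂ B₄₃ h52d h52i h43d h43i)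
  simpa only [map_mul, map_ofNat, evalP_toFormalPeriod_of, IntegralRep.value_constMul,
    IntegralRep.value_unit, mul_one] using h

/-- **`⟦β(⅚,⅓)⟧` lies in the `K`-hull of any family whose hull contains `⟦β(⅔,½)⟧`**
(`⟦[pt,4^{5/6}]⟧` is a unit of `K ⊂ P`). [this work] -/
theorem soloInformed_betaFiveSixthsThird_mem_algHull (B₅₂ B₄₃ : IntegralRep 1)
    (h52d : B₅₂.domain = {t | t 0 ∈ Ioo (0:ℝ) 1})
    (h52i : EqOn B₅₂.integrand
      (fun t => (t 0) ^ (((5 / 6 : ℚ) : ℝ) - 1) * (1 - t 0) ^ (((1 / 3 : ℚ) : ℝ) - 1)) B₅₂.domain)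
    (h43d : B₄₃.domain = {t | t 0 ∈ Ioo (0:ℝ) 1})
    (h43i : EqOn B₄₃.integrand
      (fun t => (t 0) ^ (((2 / 3 : ℚ) : ℝ) - 1) * (1 - t 0) ^ (((1 / 2 : ℚ) : ℝ) - 1)) B₄₃.domain)
    {k : ℕ} (cs : Fin k → FormalPeriodRing)
    (hB : toFormalPeriod (of B₄₃) ∈ soloInformedAlgHull cs) :
    toFormalPeriod (of B₅₂) ∈ soloInformedAlgHull cs := by
  have h40 : (4:ℝ) ^ (((5 / 6 : ℚ)) : ℝ) ≠ 0 := (Real.rpow_pos_of_pos (by norm_num) _).ne'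
  have h4 : IsAlgebraic ℚ ((4:ℝ) ^ (((5 / 6 : ℚ)) : ℝ)) := by
    simpa using soloInformed_isAlgebraic_natCast_rpow_ratCast 4 (by norm_num) (5 / 6)
  have hinv : IsAlgebraic ℚ ((4:ℝ) ^ (((5 / 6 : ℚ)) : ℝ))⁻¹ := by
    have : IsAlgebraic ℚ ((4:ℝ) ^ (((-(5 / 6) : ℚ)) : ℝ)) := by
      simpa using soloInformed_isAlgebraic_natCast_rpow_ratCast 4 (by norm_num) (-(5 / 6))
    rwa [Rat.cast_neg, Real.rpow_neg (by norm_num)] at this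
  have hW := soloInformed_secondKind_W25 h4 B₅₂ B₄₃ h52d h52i h43d h43i
  have hunit := soloInformed_pointRep_inv_mul _ h4 h40 hinv
  have hB₅₂ : toFormalPeriod (of B₅₂) = toFormalPeriod (of (IntegralRep.unit.constMul
      ((4:ℝ) ^ (((5 / 6 : ℚ)) : ℝ))⁻¹ hinv)) *
      ((toFormalPeriod (of B₄₃) + toFormalPeriod (of B₄₃)) +
        (toFormalPeriod (of B₄₃) + toFormalPeriod (of B₄₃))) := by
    calc toFormalPeriod (of B₅₂)
        = toFormalPeriod (of (IntegralRep.unit.constMul ((4:ℝ) ^ (((5 / 6 : ℚ)) : ℝ))⁻¹ hinv)) *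
            toFormalPeriod (of (IntegralRep.unit.constMul ((4:ℝ) ^ (((5 / 6 : ℚ)) : ℝ)) h4)) *
            toFormalPeriod (of B₅₂) := by rw [hunit, one_mul]
      _ = toFormalPeriod (of (IntegralRep.unit.constMul ((4:ℝ) ^ (((5 / 6 : ℚ)) : ℝ))⁻¹ hinv)) *
            (4 * toFormalPeriod (of B₄₃)) := by rw [mul_assoc, hW]
      _ = _ := by ring
  rw [hB₅₂]
  exact mul_mem (soloInformed_pointRep_mem_algHull cs _ hinv)
    (add_mem (add_mem hB hB) (add_mem hB hB))

end Summit.KontsevichZagierPeriods.KontsevichZagierPeriods.Theorems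

end
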